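import Summits.QuantumFields.BalabanUV.Beta.GAN24.StencilSlotE3OfPieces
import Summits.QuantumFields.BalabanUV.Beta.GAN24.StencilSlotSupRate

/-!
# `BalabanUV.Beta.GAN24.StencilSlotE3RateOfPieces` — binder row G-an2-4 / (CONV-C), S-slot, road «S3»: «E3SupRate» AS A KERNEL-CHECKED
# FUNCTION OF PER-PIECE SIZES AND PER-DEPTH ONE-STEP DIFFERENCES (the END-as-function of the S3 RATE table; row owner b2b-balaban-gan24-p1, gen 4)

NOT IN PRINT; OUR PROOF ATTEMPT.  HONEST FRAMING (cell contract, verbatim): «discharging `BetaPertH` makes Bałaban's UV stability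
UNCONDITIONAL — a real constructive-QFT result; it is NOT the continuum limit and NOT the Clay problem.»  HONEST DEPENDENCY (verbatim):
«continuum YM on T⁴ ⇐ BetaPertH ∧ nine spine estimates (0/9 proved); BetaPertH ⇐ (D1) ∧ (D4) ∧ CAP+tail; G-an2-4 gates asym, D1 and
NE2/3/4.»  [folklore] bookkeeping over an2's DEFINITIONS and leaf-01's member decomposition `E3UnitSplit.e3Of_succ_succ_decomp` BY NAME;
0 `def`, 0 cite, 0 `Prop` mirror, 0 sorry.  Discharges NOTHING of «E3Shape» / «E3SupRate» / «E3Drift», (hS, hSall), BetaPertH: it only fixes,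
IN THE KERNEL, what the S3 RATE leaves must prove.  NOT continuum, NOT Clay.

## What is proved (generic `d`, `Lc ≥ 1`)
* §1 `abs_weighted_diff_le` — real bookkeeping for the difference of two consecutive member decompositions PAIRED BY DEPTH
  below the top level (member `n+3` has one level more than member `n+2`; its depth-`k` piece is compared with member `n+2`'s depth-`k`
  piece, `k = 0` the top increments, `k = n−m` the lower levels via `m+1 ↔ m`; the level-`0` pieces and member `n+3`'s deepest border/Λ
  increment are unpaired and enter by their SIZES).
* §2 **`e3SupRate_of_pieces`** — «E3SupRate» (LITERALLY the hypothesis `hR` of `StencilSlotSupRate.e3Drift_of_shape_supRate`, i.e. a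
  one-step SUP-NORM rate `c·θ^j` of the normalised third-jet summand, members `j+2` vs `j+1`) FROM: the member-`2`-vs-`1` instance `h0`
  (one finite bound); four SIZE families (sup shadows of rows V0, Λ0, V, Λ of `StencilSlotE3OfPieces.e3Shape_of_pieces`: `c₀V·θ^{n+1}`,
  `c₀L·θ^{n+1}`, `c₁V·θ^{n−m}`, `c₁L·θ^{n−m}`); and five DIFFERENCE families paired by depth (Wilson `cW·θ^{n+1}`; top border / top Λ
  `cVt·θ^{n+1}`, `cLt·θ^{n+1}`; lower levels `cV·θ^{n+1}·ρ^{n−m}`, `cL·θ^{n+1}·ρ^{n−m}`, `0 ≤ ρ < 1`).  Output rate `θ`, constant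
  `max c₀₀ (|cE|·(cW + cVt + cLt + 2|c₀V| + 2|c₀L| + |c₁V| + |c₁L| + (|cV|+|cL|)·ρ/(1−ρ)))`.
READING (displayed, not claimed): the depth-`k` pieces of consecutive members are the SAME finite averaging tables one lattice scale apart read
against the normalised legs of blockings `N` and `N·Lc`; their difference is small because the legs converge (fine-offset twin of the K-slot's
`CauchyDecayK`: located input «(N1-Cauchy)») — the S3 RATE table of `SKELETON-S3.md` is, row by row, the hypothesis list below.
-/

noncomputable section

open Finset
open scoped BigOperators
open Literature.MathematicalPhysics.QuantumFieldTheory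
open Literature.MathematicalPhysics.QuantumFieldTheory.Balaban1983to89
open Literature.MathematicalPhysics.QuantumFieldTheory.Balaban1983to89.Beta
open ExpKernelCalculus (MKer BiLoc)
open OneStepResolventKernel (Fib LocStencil KInv)
open StepJetData (wilsonA mfNeg)
open AveragingHessianKernels (vhS hessFF)
open InterLevelTransport (SLam)
open BalabanStepJets (lamCoeffOf)
open BalabanCompositeJets (pushSum borderInc lagrInc)
open BalabanStepJetsSucc (e3Of wE)
open Summit.QuantumFields.BalabanUV.Beta.HessKerDressedUnits (unitS)
open Summit.QuantumFields.BalabanUV.Beta.GAN24.CombesThomas (SupBound sfStep smStep)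
open Summit.QuantumFields.BalabanUV.Beta.GAN24.E3UnitSplit (e3OfS e3Of_succ_succ_decomp)
open Summit.QuantumFields.BalabanUV.Beta.GAN24.StencilSlotE3OfPieces (unitS_e3Of sum_pow_sub_le)

namespace Summit.QuantumFields.BalabanUV.Beta.GAN24.StencilSlotE3RateOfPieces

variable {d : ℕ} {Lc : ℕ} [NeZero Lc]

/-! ## §1 Real bookkeeping: the depth-paired difference of two consecutive member decompositions -/

/-- [folklore] The weighted difference inequality in the shape of two consecutive member decompositions paired by depth: member `n+3`
(scalar `t′`, single pieces `A′ B′ C′ D′ E′`, lower levels `F m + H m`, `m < n+1`) against member `n+2` (scalar `t`, `A … E`, `G m + K m`,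
`m < n`); `A`, `D`, `E` and the lower levels `m+1 ↔ m` are paired, `B`, `C` (level `0`) and `F 0`, `H 0` (the deepest increments of member
`n+3`) enter by size. -/
theorem abs_weighted_diff_le (n : ℕ) {t t' A A' B B' C C' D D' E E' a b b' c c' dd e f₀ h₀ : ℝ} {F H G K g k : ℕ → ℝ}
    (hA : |t' * A' - t * A| ≤ a) (hB' : |t' * B'| ≤ b') (hB : |t * B| ≤ b) (hC' : |t' * C'| ≤ c') (hC : |t * C| ≤ c)
    (hD : |t' * D' - t * D| ≤ dd) (hE : |t' * E' - t * E| ≤ e) (hF0 : |t' * F 0| ≤ f₀) (hH0 : |t' * H 0| ≤ h₀)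
    (hG : ∀ m ∈ Finset.range n, |t' * F (m + 1) - t * G m| ≤ g m) (hK : ∀ m ∈ Finset.range n, |t' * H (m + 1) - t * K m| ≤ k m) :
    |t' * (A' + B' + C' + D' + E' + ∑ m ∈ Finset.range (n + 1), (F m + H m)) -
        t * (A + B + C + D + E + ∑ m ∈ Finset.range n, (G m + K m))| ≤
      a + b' + b + c' + c + dd + e + f₀ + h₀ + ∑ m ∈ Finset.range n, (g m + k m) := by
  have hS : t' * ∑ m ∈ Finset.range (n + 1), (F m + H m) - t * ∑ m ∈ Finset.range n, (G m + K m) =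
      (∑ m ∈ Finset.range n, ((t' * F (m + 1) - t * G m) + (t' * H (m + 1) - t * K m))) + t' * F 0 + t' * H 0 := by
    rw [Finset.sum_range_succ']
    simp only [mul_add, Finset.mul_sum, Finset.sum_add_distrib, Finset.sum_sub_distrib]
    ring
  have hsum : |∑ m ∈ Finset.range n, ((t' * F (m + 1) - t * G m) + (t' * H (m + 1) - t * K m))| ≤
      ∑ m ∈ Finset.range n, (g m + k m) :=
    (Finset.abs_sum_le_sum_abs _ _).trans (Finset.sum_le_sum fun m hm =>
      (abs_add_le _ _).trans (add_le_add (hG m hm) (hK m hm)))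
  have e : t' * (A' + B' + C' + D' + E' + ∑ m ∈ Finset.range (n + 1), (F m + H m)) -
        t * (A + B + C + D + E + ∑ m ∈ Finset.range n, (G m + K m)) =
      (t' * A' - t * A) + t' * B' + (-(t * B)) + t' * C' + (-(t * C)) + (t' * D' - t * D) + (t' * E' - t * E) +
        (∑ m ∈ Finset.range n, ((t' * F (m + 1) - t * G m) + (t' * H (m + 1) - t * K m))) + t' * F 0 + t' * H 0 := by
    linear_combination hS
  rw [e]
  have t₁ := abs_add_le ((t' * A' - t * A) + t' * B' + (-(t * B)) + t' * C' + (-(t * C)) + (t' * D' - t * D) + (t' * E' - t * E) +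
    (∑ m ∈ Finset.range n, ((t' * F (m + 1) - t * G m) + (t' * H (m + 1) - t * K m))) + t' * F 0) (t' * H 0)
  have t₂ := abs_add_le ((t' * A' - t * A) + t' * B' + (-(t * B)) + t' * C' + (-(t * C)) + (t' * D' - t * D) + (t' * E' - t * E) +
    (∑ m ∈ Finset.range n, ((t' * F (m + 1) - t * G m) + (t' * H (m + 1) - t * K m)))) (t' * F 0)
  have t₃ := abs_add_le ((t' * A' - t * A) + t' * B' + (-(t * B)) + t' * C' + (-(t * C)) + (t' * D' - t * D) + (t' * E' - t * E))
    (∑ m ∈ Finset.range n, ((t' * F (m + 1) - t * G m) + (t' * H (m + 1) - t * K m)))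
  have t₄ := abs_add_le ((t' * A' - t * A) + t' * B' + (-(t * B)) + t' * C' + (-(t * C)) + (t' * D' - t * D)) (t' * E' - t * E)
  have t₅ := abs_add_le ((t' * A' - t * A) + t' * B' + (-(t * B)) + t' * C' + (-(t * C))) (t' * D' - t * D)
  have t₆ := abs_add_le ((t' * A' - t * A) + t' * B' + (-(t * B)) + t' * C') (-(t * C))
  have t₇ := abs_add_le ((t' * A' - t * A) + t' * B' + (-(t * B))) (t' * C')
  have t₈ := abs_add_le ((t' * A' - t * A) + t' * B') (-(t * B))
  have t₉ := abs_add_le (t' * A' - t * A) (t' * B')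
  rw [abs_neg] at t₆ t₈
  linarith [hA, hB', hB, hC', hC, hD, hE, hF0, hH0, hsum]

/-! ## §2 «E3SupRate» from per-piece sizes and per-depth differences -/

/-- **«E3SupRate» FROM PER-PIECE SIZES AND PER-DEPTH ONE-STEP DIFFERENCES** (generic `d`, `Lc ≥ 1`; pieces VERBATIM from
`E3UnitSplit.e3Of_succ_succ_decomp` at `n` (member `n+2`, `N = Lc^{n+2}`) and at `n+1` (member `n+3`), every family a `SupBound` of
`N^{2(d+1)} · e3OfS N (piece)` or of a depth-paired difference of two such; one ratio `θ ∈ [0,1)` in the member index, one ratio `ρ ∈ [0,1)` in the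
depth): `h0` the member-`2`-vs-`1` instance; SIZES `sV0`, `sL0` (level `0`, `c₀·θ^{n+1}`), `sV`, `sL` (level `m+1` pushed `n−m` times, `c₁·θ^{n−m}` —
used only for member `n+3`'s deepest increment); DIFFERENCES `dW` (Wilson), `dVt`/`dLt` (top increments), `dV`/`dL` (level `m+2` of member `n+3`
against level `m+1` of member `n+2`, both pushed `n−m` times; constant `c·θ^{n+1}·ρ^{n−m}`).  Conclusion: LITERALLY the hypothesis `hR` of
`StencilSlotSupRate.e3Drift_of_shape_supRate` with rate `θ` and an explicit nonnegative constant. [folklore] -/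
theorem e3SupRate_of_pieces (hLc : 1 ≤ Lc) (cE cVH cΛ : ℝ) {θ ρ c₀₀ c₀V c₀L c₁V c₁L cW cVt cLt cV cL : ℝ}
    (hθ0 : 0 ≤ θ) (hθ1 : θ < 1) (hρ0 : 0 ≤ ρ) (hρ1 : ρ < 1)
    (h0 : ∀ (κ : Fin (d + 1)) (u : Fin (d + 1) → ℤ),
      SupBound (unitS (sfStep Lc 2) (smStep d Lc 2) (fun κ u => (cE * wE d Lc 2) • e3Of d Lc cE cVH cΛ 2 κ u) κ u -
        unitS (sfStep Lc 1) (smStep d Lc 1) (fun κ u => (cE * wE d Lc 1) • e3Of d Lc cE cVH cΛ 1 κ u) κ u) c₀₀)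
    (sV0 : ∀ (n : ℕ) (κ' : Fin (d + 1)) (u' : Fin (d + 1) → ℤ), SupBound (fun x z a b => ((Lc : ℝ) ^ (n + 1 + 1)) ^ (2 * (d + 1)) *
      e3OfS (Lc ^ (n + 1 + 1)) (fun κ u => (((Lc : ℝ) ^ (d + 1)) ^ (n + 1) * cVH) • pushSum Lc (Lc ^ (n + 1)) (mfNeg (vhS d Lc κ u))) κ' u' x z a b) (c₀V * θ ^ (n + 1)))
    (sL0 : ∀ (n : ℕ) (κ' : Fin (d + 1)) (u' : Fin (d + 1) → ℤ), SupBound (fun x z a b => ((Lc : ℝ) ^ (n + 1 + 1)) ^ (2 * (d + 1)) *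
      e3OfS (Lc ^ (n + 1 + 1)) (fun κ u => (((Lc : ℝ) ^ (d + 1)) ^ (n + 1) * cΛ) •
        SLam Lc (lamCoeffOf (KInv (N := Lc) (d := d)) Lc) (fun μ y => hessFF Lc μ y) κ u) κ' u' x z a b) (c₀L * θ ^ (n + 1)))
    (sV : ∀ (n m : ℕ), m < n → ∀ (κ' : Fin (d + 1)) (u' : Fin (d + 1) → ℤ), SupBound (fun x z a b => ((Lc : ℝ) ^ (n + 1 + 1)) ^ (2 * (d + 1)) *
      e3OfS (Lc ^ (n + 1 + 1)) (fun κ u => ((((Lc : ℝ) ^ (d + 1)) ^ (n - m) * (cVH * ((Lc : ℝ) ^ (m + 1)) ^ (d + 2))) •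
        pushSum (Lc ^ (m + 1 + 1)) (Lc ^ (n - m)) (borderInc d Lc (Lc ^ (m + 1)) κ u))) κ' u' x z a b) (c₁V * θ ^ (n - m)))
    (sL : ∀ (n m : ℕ), m < n → ∀ (κ' : Fin (d + 1)) (u' : Fin (d + 1) → ℤ), SupBound (fun x z a b => ((Lc : ℝ) ^ (n + 1 + 1)) ^ (2 * (d + 1)) *
      e3OfS (Lc ^ (n + 1 + 1)) (fun κ u => ((((Lc : ℝ) ^ (d + 1)) ^ (n - m) * (cΛ * ((Lc : ℝ) ^ (m + 1)) ^ (2 * d + 4))) •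
        lagrInc d Lc (Lc ^ (m + 1)) (Lc ^ (m + 1 + 1)) κ u)) κ' u' x z a b) (c₁L * θ ^ (n - m)))
    (dW : ∀ (n : ℕ) (κ' : Fin (d + 1)) (u' : Fin (d + 1) → ℤ), SupBound (fun x z a b =>
      ((Lc : ℝ) ^ (n + 1 + 1 + 1)) ^ (2 * (d + 1)) * e3OfS (Lc ^ (n + 1 + 1 + 1)) (fun κ u => (cE * ((Lc : ℝ) ^ (d + 1)) ^ (n + 1 + 1)) • wilsonA d κ u) κ' u' x z a b -
      ((Lc : ℝ) ^ (n + 1 + 1)) ^ (2 * (d + 1)) * e3OfS (Lc ^ (n + 1 + 1)) (fun κ u => (cE * ((Lc : ℝ) ^ (d + 1)) ^ (n + 1)) • wilsonA d κ u) κ' u' x z a b) (cW * θ ^ (n + 1)))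
    (dVt : ∀ (n : ℕ) (κ' : Fin (d + 1)) (u' : Fin (d + 1) → ℤ), SupBound (fun x z a b =>
      ((Lc : ℝ) ^ (n + 1 + 1 + 1)) ^ (2 * (d + 1)) * e3OfS (Lc ^ (n + 1 + 1 + 1)) (fun κ u => (cVH * ((Lc : ℝ) ^ (n + 1 + 1)) ^ (d + 2)) • borderInc d Lc (Lc ^ (n + 1 + 1)) κ u) κ' u' x z a b -
      ((Lc : ℝ) ^ (n + 1 + 1)) ^ (2 * (d + 1)) * e3OfS (Lc ^ (n + 1 + 1)) (fun κ u => (cVH * ((Lc : ℝ) ^ (n + 1)) ^ (d + 2)) • borderInc d Lc (Lc ^ (n + 1)) κ u) κ' u' x z a b) (cVt * θ ^ (n + 1)))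
    (dLt : ∀ (n : ℕ) (κ' : Fin (d + 1)) (u' : Fin (d + 1) → ℤ), SupBound (fun x z a b =>
      ((Lc : ℝ) ^ (n + 1 + 1 + 1)) ^ (2 * (d + 1)) * e3OfS (Lc ^ (n + 1 + 1 + 1)) (fun κ u => (cΛ * ((Lc : ℝ) ^ (n + 1 + 1)) ^ (2 * d + 4)) •
        lagrInc d Lc (Lc ^ (n + 1 + 1)) (Lc ^ (n + 1 + 1 + 1)) κ u) κ' u' x z a b -
      ((Lc : ℝ) ^ (n + 1 + 1)) ^ (2 * (d + 1)) * e3OfS (Lc ^ (n + 1 + 1)) (fun κ u => (cΛ * ((Lc : ℝ) ^ (n + 1)) ^ (2 * d + 4)) •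
        lagrInc d Lc (Lc ^ (n + 1)) (Lc ^ (n + 1 + 1)) κ u) κ' u' x z a b) (cLt * θ ^ (n + 1)))
    (dV : ∀ (n m : ℕ), m < n → ∀ (κ' : Fin (d + 1)) (u' : Fin (d + 1) → ℤ), SupBound (fun x z a b =>
      ((Lc : ℝ) ^ (n + 1 + 1 + 1)) ^ (2 * (d + 1)) * e3OfS (Lc ^ (n + 1 + 1 + 1)) (fun κ u => ((((Lc : ℝ) ^ (d + 1)) ^ (n - m) * (cVH * ((Lc : ℝ) ^ (m + 1 + 1)) ^ (d + 2))) •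
        pushSum (Lc ^ (m + 1 + 1 + 1)) (Lc ^ (n - m)) (borderInc d Lc (Lc ^ (m + 1 + 1)) κ u))) κ' u' x z a b -
      ((Lc : ℝ) ^ (n + 1 + 1)) ^ (2 * (d + 1)) * e3OfS (Lc ^ (n + 1 + 1)) (fun κ u => ((((Lc : ℝ) ^ (d + 1)) ^ (n - m) * (cVH * ((Lc : ℝ) ^ (m + 1)) ^ (d + 2))) •
        pushSum (Lc ^ (m + 1 + 1)) (Lc ^ (n - m)) (borderInc d Lc (Lc ^ (m + 1)) κ u))) κ' u' x z a b) (cV * θ ^ (n + 1) * ρ ^ (n - m)))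
    (dL : ∀ (n m : ℕ), m < n → ∀ (κ' : Fin (d + 1)) (u' : Fin (d + 1) → ℤ), SupBound (fun x z a b =>
      ((Lc : ℝ) ^ (n + 1 + 1 + 1)) ^ (2 * (d + 1)) * e3OfS (Lc ^ (n + 1 + 1 + 1)) (fun κ u => ((((Lc : ℝ) ^ (d + 1)) ^ (n - m) * (cΛ * ((Lc : ℝ) ^ (m + 1 + 1)) ^ (2 * d + 4))) •
        lagrInc d Lc (Lc ^ (m + 1 + 1)) (Lc ^ (m + 1 + 1 + 1)) κ u)) κ' u' x z a b -
      ((Lc : ℝ) ^ (n + 1 + 1)) ^ (2 * (d + 1)) * e3OfS (Lc ^ (n + 1 + 1)) (fun κ u => ((((Lc : ℝ) ^ (d + 1)) ^ (n - m) * (cΛ * ((Lc : ℝ) ^ (m + 1)) ^ (2 * d + 4))) •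
        lagrInc d Lc (Lc ^ (m + 1)) (Lc ^ (m + 1 + 1)) κ u)) κ' u' x z a b) (cL * θ ^ (n + 1) * ρ ^ (n - m)))
    (j : ℕ) (κ : Fin (d + 1)) (u : Fin (d + 1) → ℤ) :
    SupBound (unitS (sfStep Lc (j + 2)) (smStep d Lc (j + 2)) (fun κ u => (cE * wE d Lc (j + 2)) • e3Of d Lc cE cVH cΛ (j + 2) κ u) κ u -
        unitS (sfStep Lc (j + 1)) (smStep d Lc (j + 1)) (fun κ u => (cE * wE d Lc (j + 1)) • e3Of d Lc cE cVH cΛ (j + 1) κ u) κ u)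
      (max c₀₀ (|cE| * (cW + cVt + cLt + 2 * |c₀V| + 2 * |c₀L| + |c₁V| + |c₁L| + (|cV| + |cL|) * (ρ / (1 - ρ)))) * θ ^ j) := by
  have hc₀₀ : 0 ≤ c₀₀ := (h0 0 0).nonneg (Sum.inl 0)
  set K : ℝ := cW + cVt + cLt + 2 * |c₀V| + 2 * |c₀L| + |c₁V| + |c₁L| + (|cV| + |cL|) * (ρ / (1 - ρ)) with hK
  rcases j with _ | n
  · -- members 2 and 1: the given instance
    simp only [zero_add, pow_zero, mul_one]
    exact fun x y a b => (h0 κ u x y a b).trans (le_max_left _ _)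
  · -- members n+3 and n+2: both decompositions, paired by depth
    rw [show n + 1 + 2 = n + 1 + 1 + 1 from rfl, unitS_e3Of, unitS_e3Of]
    intro x z a b
    simp only [Pi.sub_apply, Pi.smul_apply, smul_eq_mul]
    rw [e3Of_succ_succ_decomp hLc cE cVH cΛ (n + 1) κ u x z a b, e3Of_succ_succ_decomp hLc cE cVH cΛ n κ u x z a b,
      mul_assoc, mul_assoc, ← mul_sub, abs_mul]
    -- the eleven bound families at this (n, κ, u, x, z, a, b)
    have bG : ∀ m ∈ Finset.range n,
        |((Lc : ℝ) ^ (n + 1 + 1 + 1)) ^ (2 * (d + 1)) * e3OfS (Lc ^ (n + 1 + 1 + 1)) (fun κ u => ((((Lc : ℝ) ^ (d + 1)) ^ (n + 1 - (m + 1)) * (cVH * ((Lc : ℝ) ^ (m + 1 + 1)) ^ (d + 2))) •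
        pushSum (Lc ^ (m + 1 + 1 + 1)) (Lc ^ (n + 1 - (m + 1))) (borderInc d Lc (Lc ^ (m + 1 + 1)) κ u))) κ u x z a b -
          ((Lc : ℝ) ^ (n + 1 + 1)) ^ (2 * (d + 1)) * e3OfS (Lc ^ (n + 1 + 1)) (fun κ u => ((((Lc : ℝ) ^ (d + 1)) ^ (n - m) * (cVH * ((Lc : ℝ) ^ (m + 1)) ^ (d + 2))) •
        pushSum (Lc ^ (m + 1 + 1)) (Lc ^ (n - m)) (borderInc d Lc (Lc ^ (m + 1)) κ u))) κ u x z a b| ≤ cV * θ ^ (n + 1) * ρ ^ (n - m) := by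
      intro m hm
      have h := dV n m (Finset.mem_range.1 hm) κ u x z a b
      simp only [Nat.add_sub_add_right] at h ⊢
      exact h
    have bK : ∀ m ∈ Finset.range n,
        |((Lc : ℝ) ^ (n + 1 + 1 + 1)) ^ (2 * (d + 1)) * e3OfS (Lc ^ (n + 1 + 1 + 1)) (fun κ u => ((((Lc : ℝ) ^ (d + 1)) ^ (n + 1 - (m + 1)) * (cΛ * ((Lc : ℝ) ^ (m + 1 + 1)) ^ (2 * d + 4))) •
        lagrInc d Lc (Lc ^ (m + 1 + 1)) (Lc ^ (m + 1 + 1 + 1)) κ u)) κ u x z a b -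
          ((Lc : ℝ) ^ (n + 1 + 1)) ^ (2 * (d + 1)) * e3OfS (Lc ^ (n + 1 + 1)) (fun κ u => ((((Lc : ℝ) ^ (d + 1)) ^ (n - m) * (cΛ * ((Lc : ℝ) ^ (m + 1)) ^ (2 * d + 4))) •
        lagrInc d Lc (Lc ^ (m + 1)) (Lc ^ (m + 1 + 1)) κ u)) κ u x z a b| ≤ cL * θ ^ (n + 1) * ρ ^ (n - m) := by
      intro m hm
      have h := dL n m (Finset.mem_range.1 hm) κ u x z a b
      simp only [Nat.add_sub_add_right] at h ⊢
      exact h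
    have hmain := abs_weighted_diff_le n
      (F := fun m => e3OfS (Lc ^ (n + 1 + 1 + 1)) (fun κ u => ((((Lc : ℝ) ^ (d + 1)) ^ (n + 1 - m) * (cVH * ((Lc : ℝ) ^ (m + 1)) ^ (d + 2))) •
        pushSum (Lc ^ (m + 1 + 1)) (Lc ^ (n + 1 - m)) (borderInc d Lc (Lc ^ (m + 1)) κ u))) κ u x z a b)
      (H := fun m => e3OfS (Lc ^ (n + 1 + 1 + 1)) (fun κ u => ((((Lc : ℝ) ^ (d + 1)) ^ (n + 1 - m) * (cΛ * ((Lc : ℝ) ^ (m + 1)) ^ (2 * d + 4))) •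
        lagrInc d Lc (Lc ^ (m + 1)) (Lc ^ (m + 1 + 1)) κ u)) κ u x z a b)
      (G := fun m => e3OfS (Lc ^ (n + 1 + 1)) (fun κ u => ((((Lc : ℝ) ^ (d + 1)) ^ (n - m) * (cVH * ((Lc : ℝ) ^ (m + 1)) ^ (d + 2))) •
        pushSum (Lc ^ (m + 1 + 1)) (Lc ^ (n - m)) (borderInc d Lc (Lc ^ (m + 1)) κ u))) κ u x z a b)
      (K := fun m => e3OfS (Lc ^ (n + 1 + 1)) (fun κ u => ((((Lc : ℝ) ^ (d + 1)) ^ (n - m) * (cΛ * ((Lc : ℝ) ^ (m + 1)) ^ (2 * d + 4))) •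
        lagrInc d Lc (Lc ^ (m + 1)) (Lc ^ (m + 1 + 1)) κ u)) κ u x z a b)
      (dW n κ u x z a b) (sV0 (n + 1) κ u x z a b) (sV0 n κ u x z a b)
      (sL0 (n + 1) κ u x z a b) (sL0 n κ u x z a b) (dVt n κ u x z a b) (dLt n κ u x z a b)
      (sV (n + 1) 0 (Nat.succ_pos n) κ u x z a b) (sL (n + 1) 0 (Nat.succ_pos n) κ u x z a b) bG bK
    refine le_trans (mul_le_mul_of_nonneg_left hmain (abs_nonneg cE)) ?_
    -- the real arithmetic: the total is ≤ K·θ^{n+1}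
    have hθp : 0 ≤ θ ^ (n + 1) := pow_nonneg hθ0 _
    have h1ρ : 0 < 1 - ρ := by linarith
    have hρs := sum_pow_sub_le hρ0 hρ1 n
    have hs0 : 0 ≤ ∑ m ∈ Finset.range n, ρ ^ (n - m) := Finset.sum_nonneg fun m _ => pow_nonneg hρ0 _
    have hgeom : ∑ m ∈ Finset.range n, (cV * θ ^ (n + 1) * ρ ^ (n - m) + cL * θ ^ (n + 1) * ρ ^ (n - m)) =
        θ ^ (n + 1) * ((cV + cL) * ∑ m ∈ Finset.range n, ρ ^ (n - m)) := by
      rw [Finset.mul_sum, Finset.mul_sum]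
      exact Finset.sum_congr rfl fun m _ => by ring
    have e0 : θ ^ (n + 1 - 0) = θ ^ (n + 1) := by rw [Nat.sub_zero]
    have e2 : θ ^ (n + 1 + 1) = θ ^ (n + 1) * θ := pow_succ θ (n + 1)
    have hlev : (cV + cL) * ∑ m ∈ Finset.range n, ρ ^ (n - m) ≤ (|cV| + |cL|) * (ρ / (1 - ρ)) :=
      calc (cV + cL) * ∑ m ∈ Finset.range n, ρ ^ (n - m) ≤ (|cV| + |cL|) * ∑ m ∈ Finset.range n, ρ ^ (n - m) :=
            mul_le_mul_of_nonneg_right ((le_abs_self _).trans (abs_add_le _ _)) hs0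
        _ ≤ (|cV| + |cL|) * (ρ / (1 - ρ)) := mul_le_mul_of_nonneg_left hρs (by positivity)
    have hc0V : c₀V * θ ≤ |c₀V| := by
      calc c₀V * θ ≤ |c₀V| * θ := mul_le_mul_of_nonneg_right (le_abs_self _) hθ0
        _ ≤ |c₀V| * 1 := mul_le_mul_of_nonneg_left hθ1.le (abs_nonneg _)
        _ = |c₀V| := mul_one _
    have hc0L : c₀L * θ ≤ |c₀L| := by
      calc c₀L * θ ≤ |c₀L| * θ := mul_le_mul_of_nonneg_right (le_abs_self _) hθ0
        _ ≤ |c₀L| * 1 := mul_le_mul_of_nonneg_left hθ1.le (abs_nonneg _)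
        _ = |c₀L| := mul_one _
    have hbr : cW + c₀V * θ + c₀V + c₀L * θ + c₀L + cVt + cLt + c₁V + c₁L + (cV + cL) * ∑ m ∈ Finset.range n, ρ ^ (n - m) ≤ K := by
      rw [hK]
      linarith [le_abs_self c₀V, le_abs_self c₀L, le_abs_self c₁V, le_abs_self c₁L]
    have hTOT : cW * θ ^ (n + 1) + c₀V * θ ^ (n + 1 + 1) + c₀V * θ ^ (n + 1) + c₀L * θ ^ (n + 1 + 1) + c₀L * θ ^ (n + 1) +
        cVt * θ ^ (n + 1) + cLt * θ ^ (n + 1) + c₁V * θ ^ (n + 1 - 0) + c₁L * θ ^ (n + 1 - 0) +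
        ∑ m ∈ Finset.range n, (cV * θ ^ (n + 1) * ρ ^ (n - m) + cL * θ ^ (n + 1) * ρ ^ (n - m)) ≤ K * θ ^ (n + 1) := by
      rw [hgeom, e0, e2]
      calc cW * θ ^ (n + 1) + c₀V * (θ ^ (n + 1) * θ) + c₀V * θ ^ (n + 1) + c₀L * (θ ^ (n + 1) * θ) + c₀L * θ ^ (n + 1) +
            cVt * θ ^ (n + 1) + cLt * θ ^ (n + 1) + c₁V * θ ^ (n + 1) + c₁L * θ ^ (n + 1) +
            θ ^ (n + 1) * ((cV + cL) * ∑ m ∈ Finset.range n, ρ ^ (n - m))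
          = θ ^ (n + 1) * (cW + c₀V * θ + c₀V + c₀L * θ + c₀L + cVt + cLt + c₁V + c₁L +
              (cV + cL) * ∑ m ∈ Finset.range n, ρ ^ (n - m)) := by ring
        _ ≤ θ ^ (n + 1) * K := mul_le_mul_of_nonneg_left hbr hθp
        _ = K * θ ^ (n + 1) := mul_comm _ _
    calc |cE| * _ ≤ |cE| * (K * θ ^ (n + 1)) := mul_le_mul_of_nonneg_left hTOT (abs_nonneg _)
      _ = (|cE| * K) * θ ^ (n + 1) := by ring
      _ ≤ max c₀₀ (|cE| * K) * θ ^ (n + 1) := mul_le_mul_of_nonneg_right (le_max_right _ _) hθp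

end Summit.QuantumFields.BalabanUV.Beta.GAN24.StencilSlotE3RateOfPieces
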